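import Summits.QuantumFields.YangMills.Theorems.UnitScaleTiltProp7CombLadderCount
import HarnessLib

/-!
# Route `UnitScaleTilt`, crux K1 «MinimiserStabilityRegPr» (stmt-QuantumFields-19200), route-R E′ path (α′), S3 K-form engine, row (R4′) — FILE 9h′ «THE COUNT», part 2:
# COMB-PREFIX CANONICITY (a prefix of a comb IS the comb to its own endpoint) and THE OFFSET AVERAGE (shifting the base `H` times along the last comb
# direction spreads the first run's trunk plane, so the SUM over the `H` offsets of the first-run rung sums carries NO factor `H`)

Cell `ym3-torus`, width seat `ym3-torus-px9` (gen 3); row (R4′) lineage of `ym-routeR-w1` g6 («px9: F-H9h GO» 22:00Z; «shape OK … (C3) as file 2» + optional (C5) 22:02Z;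
namer ★ym-ust-19200-p1 g15, standing PASS).  THEOREMS ONLY (0 `def`, 0 `sorry`); `--supports stmt-QuantumFields-19200 --as helper`, count-neutral.  YM₃ on T³ is a RUNG of
the ladder (R3) — not d = 4, not infinite volume, not a mass gap, not the Clay problem; nothing here claims a stub, the crux or any summit statement.

THE POINT.  (C5) In ✓ `Prop7CombLadder.comm_hol_contour27_le_*` the `k`-th rung is TRANSPORTED by `hol V 0 (A ++ seg μ (v μ) ++ B.take k)`; since the endpoint of that prefix
still has all LATER coordinates `0`, the prefix is LITERALLY `treeWord` of its endpoint — so the transport is the axial transport to the rung position `q_k`, a function of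
`q_k` alone, and routeR-w1's junction majorant ✓p672426 `comm_rung_sq_le` becomes a weight `f (q_k, letter)` as ✓ `Prop7CombLadderCount` wants.  (C3) The first run of the tail
(direction `t[0]`) is the expensive one: its rungs have all later coordinates `0` (the «trunk plane»), so a fixed rung is met by `(2R+1)^{d − |D|}` combs.  With the base shifted
to `h • e ι` (`ι` a LATER direction, ✓ `Prop7AxialOffsetFamily`), the trunk plane of offset `h` is `{q ι = h}`: a fixed ABSOLUTE rung position determines `h`, so summed over
`h < H` the first-run fibre is still `(2R+1)^{d − |D|}` — NOT `H` times it; the later runs keep their file-1 factors (once per offset).  Dividing by `H` (the average of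
✓ `lemmaH_curved_comb_avg`) is the consumer's: at `d = 3`, `R = 3ℓ`, `H = ℓ` this is routeR-w1's `≤ 13(6ℓ+1)`.

WHAT IS PROVED (ns `…Theorems.Prop7CombLadderCountOffset`; letters of ✓ `Prop7CombLadderCount`).
* §1 (C5): `take_seg` (`(seg κ n).take j = seg κ (sign n · j)`), ★ `flatMap_seg_disp_take` (the prefix of a tail equals the tail-word of its own displacement, and that
  displacement vanishes off `t`), ★★★ `treeWord_disp_prefix` — `treeWord (disp (A ++ seg μ (v μ) ++ B.take k)) = A ++ seg μ (v μ) ++ B.take k` (`k ≤ |B|`).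
* §2 (C3), ONE RUN SUMMED OVER THE OFFSETS: ★★ `sum_offsets_box_run_le` — for `κ ∉ D`, `ι ∉ D`, `ι ≠ κ`:
  `Σ_{h<H} Σ_{v∈box R} Σ_{j<|v κ|} f (h•e ι + base_D v + rung_j) letter_j ≤ (2R+1)^{d−|D|} · Σ_{q ∈ box (R+H)} (f q (κ,+) + f q (κ,−))` (no factor `H`).
* §3 (C3), THE LATER RUNS AND THE ASSEMBLY: `sum_offsets_shift_le` (`Σ_{h<H} Σ_{q∈box R} F (h•e ι + q) ≤ H · Σ_{q∈box (R+H)} F q`),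
  ★★★ `sum_offsets_box_sum_rungs_le` — for `t = κ :: t'` nodup, disjoint from `D`, `ι ∈ t'`:
  `Σ_{h<H} Σ_{v∈box R} Σ_{k<|B|} f (h•e ι + base_D v + disp (B.take k)) (B.getD k dflt) ≤ (2R+1)^{d−|D|}·Σ_{q∈box(R+H)} F_κ q + H·Σ_{i<|t'|} (2R+1)^{d−(|D|+1+i)}·Σ_{q∈box(R+H)} F_{t'[i]} q`.
HONEST SCOPE.  Finite combinatorics on `ℤ^d` words; no holonomy, no smallness; the division by `H`, the junction and the identification of routeR-w1's offset bases with
`h • e ι` in pulled-back coordinates (✓ `Prop7AxialOffsetFamily`) are the consumer's.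

References: T. Bałaban, CMP 98 (1985) 17–51 [Balaban1985Averaging] ((8)–(9) pp.18–19, p.24); CMP 95 (1984) 17–40 [Balaban1984PropagatorsI] ((1.7) p.18); CMP 102 (1985)
255–275 [Balaban1985UV3] ((27) p.263).
-/

set_option autoImplicit false

open scoped BigOperators

namespace Summit.QuantumFields.YangMills.Theorems.Prop7CombLadderCountOffset

open Literature.MathematicalPhysics.QuantumFieldTheory.Balaban1983to89
open B7Prop1Explicit (Site Letter e e_apply disp seg treeWord disp_append disp_seg length_seg seg_natCast seg_negSucc seg_neg_natCast seg_zero)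
open Summit.QuantumFields.YangMills.Theorems.Prop7CombLadder (treeWord_split)
open Summit.QuantumFields.YangMills.Theorems.Prop7CombLadderCount (disp_flatMap_seg sum_map_zsmul_e_apply sum_zsmul_e_apply mem_box_iff card_filter_agree_le
  disp_take_seg getD_seg sum_range_rungs_append sum_box_sum_rungs_le split_nodup)

variable {d : ℕ}

/-! ## §1 (C5) Comb-prefix canonicity -/

/-- A prefix of a run is a run: `(seg κ n).take j = seg κ (sign n · j)` for `j ≤ |n|`. [cite: Balaban1985Averaging, p.24] -/
theorem take_seg (κ : Fin d) (n : ℤ) (j : ℕ) (hj : j ≤ n.natAbs) : (seg κ n).take j = seg κ (n.sign * (j : ℤ)) := by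
  cases n with
  | ofNat m =>
    rw [Int.ofNat_eq_natCast, seg_natCast, List.take_replicate, Nat.min_eq_left (by simpa using hj)]
    rcases Nat.eq_zero_or_pos m with hm | hm
    · subst hm
      have : j = 0 := by simpa using hj
      subst this; simp
    · rw [Int.sign_natCast_of_ne_zero hm.ne', one_mul, seg_natCast]
  | negSucc m =>
    rw [seg_negSucc, List.take_replicate, Nat.min_eq_left (by simpa using hj), Int.sign_negSucc, neg_mul, one_mul, seg_neg_natCast]

/-- ★ THE PREFIX OF A TAIL IS THE TAIL-WORD OF ITS OWN DISPLACEMENT, and that displacement vanishes off `t` (`t.Nodup`, `k ≤ |B|`).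
[cite: Balaban1984PropagatorsI, (1.7) p.18] -/
theorem flatMap_seg_disp_take :
    ∀ (t : List (Fin d)), t.Nodup → ∀ (v : Site d) (k : ℕ), k ≤ (t.flatMap (fun κ => seg κ (v κ))).length →
      (∀ κ, κ ∉ t → disp ((t.flatMap (fun κ => seg κ (v κ))).take k) κ = 0) ∧
      t.flatMap (fun κ => seg κ (disp ((t.flatMap (fun κ => seg κ (v κ))).take k) κ)) = (t.flatMap (fun κ => seg κ (v κ))).take k
  | [], _, v, k, hk => by
    simp only [List.flatMap_nil, List.length_nil, Nat.le_zero] at hk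
    subst hk
    simp
  | κ₁ :: t, hnd, v, k, hk => by
    have hκt : κ₁ ∉ t := (List.nodup_cons.mp hnd).1
    have hnd' : t.Nodup := (List.nodup_cons.mp hnd).2
    rw [List.flatMap_cons] at hk ⊢
    rw [List.length_append, length_seg] at hk
    by_cases hk1 : k ≤ (v κ₁).natAbs
    · -- the prefix stops inside the first run
      have htake : (seg κ₁ (v κ₁) ++ t.flatMap (fun κ => seg κ (v κ))).take k = seg κ₁ ((v κ₁).sign * (k : ℤ)) := by
        rw [List.take_append_of_le_length (by rwa [length_seg]), take_seg κ₁ (v κ₁) k hk1]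
      rw [htake, disp_seg]
      refine ⟨fun κ hκ => ?_, ?_⟩
      · have hne : κ ≠ κ₁ := fun h => hκ (by simp [h])
        rw [Pi.smul_apply, e_apply, if_neg hne, smul_zero]
      · rw [List.flatMap_cons, Pi.smul_apply, e_apply, if_pos rfl, smul_eq_mul, mul_one]
        have hrest : t.flatMap (fun κ => seg κ ((((v κ₁).sign * (k : ℤ)) • e κ₁) κ)) = [] := by
          rw [List.flatMap_eq_nil_iff]
          intro κ hκ
          have hne : κ ≠ κ₁ := fun h => hκt (h ▸ hκ)
          rw [Pi.smul_apply, e_apply, if_neg hne, smul_zero, seg_zero]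
        rw [hrest, List.append_nil]
    · -- the prefix contains the whole first run
      rw [not_le] at hk1
      obtain ⟨k', rfl⟩ : ∃ k', k = (v κ₁).natAbs + k' := ⟨k - (v κ₁).natAbs, by omega⟩
      have hk' : k' ≤ (t.flatMap (fun κ => seg κ (v κ))).length := by omega
      have htake : (seg κ₁ (v κ₁) ++ t.flatMap (fun κ => seg κ (v κ))).take ((v κ₁).natAbs + k')
          = seg κ₁ (v κ₁) ++ (t.flatMap (fun κ => seg κ (v κ))).take k' := by
        rw [← length_seg κ₁ (v κ₁), List.take_length_add_append]
      obtain ⟨ih0, ih1⟩ := flatMap_seg_disp_take t hnd' v k' hk'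
      rw [htake, disp_append, disp_seg]
      refine ⟨fun κ hκ => ?_, ?_⟩
      · have hne : κ ≠ κ₁ := fun h => hκ (by simp [h])
        have hκt' : κ ∉ t := fun h => hκ (by simp [h])
        rw [Pi.add_apply, Pi.smul_apply, e_apply, if_neg hne, smul_zero, zero_add, ih0 κ hκt']
      · rw [List.flatMap_cons, Pi.add_apply, Pi.smul_apply, e_apply, if_pos rfl, smul_eq_mul, mul_one, ih0 κ₁ hκt, add_zero]
        congr 1
        rw [← ih1]
        refine List.flatMap_congr fun κ hκ => ?_
        have hne : κ ≠ κ₁ := fun h => hκt (h ▸ hκ)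
        rw [ih1, Pi.add_apply, Pi.smul_apply, e_apply, if_neg hne, smul_zero, zero_add]

/-- ★★★ **COMB-PREFIX CANONICITY**: for the split `(finRange d).reverse = s ++ μ :: t` and `k ≤ |B|`, the transport word of the `k`-th rung IS the comb to the rung position:
`treeWord (disp (A ++ seg μ (v μ) ++ B.take k)) = A ++ seg μ (v μ) ++ B.take k` — so `hol V 0 (A ++ seg μ (v μ) ++ B↾k)` is the axial transport to `q_k`, a function of `q_k` alone.
[cite: Balaban1984PropagatorsI, (1.7) p.18; Balaban1985UV3, (27) p.263] -/
theorem treeWord_disp_prefix (μ : Fin d) {s t : List (Fin d)} (h : (List.finRange d).reverse = s ++ μ :: t) (v : Site d) (k : ℕ)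
    (hk : k ≤ (t.flatMap (fun κ => seg κ (v κ))).length) :
    treeWord (disp (s.flatMap (fun κ => seg κ (v κ)) ++ seg μ (v μ) ++ (t.flatMap (fun κ => seg κ (v κ))).take k))
      = s.flatMap (fun κ => seg κ (v κ)) ++ seg μ (v μ) ++ (t.flatMap (fun κ => seg κ (v κ))).take k := by
  obtain ⟨hs, ht, hμs, hμt, hts, -⟩ := split_nodup μ h
  obtain ⟨h0, h1⟩ := flatMap_seg_disp_take t ht v k hk
  set p := disp (s.flatMap (fun κ => seg κ (v κ)) ++ seg μ (v μ) ++ (t.flatMap (fun κ => seg κ (v κ))).take k) with hp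
  -- coordinates of the endpoint
  have hcoord : ∀ κ, p κ = (if κ ∈ s then v κ else 0) + (if κ = μ then v μ else 0) + disp ((t.flatMap (fun κ => seg κ (v κ))).take k) κ := by
    intro κ
    rw [hp, disp_append, disp_append, disp_flatMap_seg, disp_seg, Pi.add_apply, Pi.add_apply, sum_map_zsmul_e_apply s hs, Pi.smul_apply, e_apply,
      smul_eq_mul, mul_ite, mul_one, mul_zero]
  have hps : ∀ κ ∈ s, p κ = v κ := by
    intro κ hκ
    have hκμ : κ ≠ μ := fun h' => hμs (h' ▸ hκ)
    have hκt : κ ∉ t := fun h' => hts κ h' hκ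
    rw [hcoord, if_pos hκ, if_neg hκμ, h0 κ hκt, add_zero, add_zero]
  have hpμ : p μ = v μ := by
    have hμt' : μ ∉ t := hμt
    rw [hcoord, if_neg hμs, if_pos rfl, h0 μ hμt', zero_add, add_zero]
  have hpt : ∀ κ ∈ t, p κ = disp ((t.flatMap (fun κ => seg κ (v κ))).take k) κ := by
    intro κ hκ
    have hκs : κ ∉ s := hts κ hκ
    have hκμ : κ ≠ μ := fun h' => hμt (h' ▸ hκ)
    rw [hcoord, if_neg hκs, if_neg hκμ, zero_add, zero_add]
  have e1 : s.flatMap (fun κ => seg κ (p κ)) = s.flatMap (fun κ => seg κ (v κ)) :=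
    List.flatMap_congr (fun κ hκ => by rw [hps κ hκ])
  have e2 : t.flatMap (fun κ => seg κ (p κ)) = t.flatMap (fun κ => seg κ (disp ((t.flatMap (fun κ => seg κ (v κ))).take k) κ)) :=
    List.flatMap_congr (fun κ hκ => by rw [hpt κ hκ])
  rw [treeWord_split p μ h, hpμ, e1, e2, h1]

/-! ## §2 (C3) The first run summed over the offsets: no factor `H` -/

/-- the shifted box: `q ∈ box R`, `0 ≤ h < H` ⇒ `h • e ι + q ∈ box (R + H)`. [folklore] -/
theorem shift_mem_box {R H : ℕ} (ι : Fin d) {h : ℕ} (hh : h < H) {q : Site d}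
    (hq : q ∈ Fintype.piFinset (fun _ : Fin d => Finset.Icc (-(R : ℤ)) (R : ℤ))) :
    ((h : ℤ) • e ι + q) ∈ Fintype.piFinset (fun _ : Fin d => Finset.Icc (-((R + H : ℕ) : ℤ)) ((R + H : ℕ) : ℤ)) := by
  rw [mem_box_iff] at hq ⊢
  intro κ
  rw [Pi.add_apply, Pi.smul_apply, e_apply, smul_eq_mul]
  have := hq κ
  split_ifs <;> push_cast <;> constructor <;> nlinarith

/-- STEP A′ (one offset, one comb, first run): the rung sum is at most the `F`-sum over the points of the big box agreeing with `v` on `D` and having `ι`-coordinate `h`.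
[cite: Balaban1985Averaging, p.24] -/
theorem sum_run_le_sum_agree_offset (R H : ℕ) (D : Finset (Fin d)) (κ ι : Fin d) (hκ : κ ∉ D) (hι : ι ∉ D) (hικ : ι ≠ κ) (dflt : Letter d)
    (f : Site d → Letter d → ℝ) (hf : ∀ q b, 0 ≤ f q b) {h : ℕ} (hh : h < H) (v : Site d)
    (hv : v ∈ Fintype.piFinset (fun _ : Fin d => Finset.Icc (-(R : ℤ)) (R : ℤ))) :
    ∑ j ∈ Finset.range (seg κ (v κ)).length, f ((h : ℤ) • e ι + (∑ ν ∈ D, v ν • e ν) + disp ((seg κ (v κ)).take j)) ((seg κ (v κ)).getD j dflt)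
      ≤ ∑ q ∈ (Fintype.piFinset (fun _ : Fin d => Finset.Icc (-((R + H : ℕ) : ℤ)) ((R + H : ℕ) : ℤ))).filter
            (fun q => (∀ ν ∈ D, q ν = v ν) ∧ q ι = (h : ℤ)), (f q (κ, true) + f q (κ, false)) := by
  classical
  rw [length_seg]
  have hvb := (mem_box_iff (R := R)).mp hv
  have hpos : ∀ j ∈ Finset.range (v κ).natAbs,
      (h : ℤ) • e ι + (∑ ν ∈ D, v ν • e ν) + disp ((seg κ (v κ)).take j) = (h : ℤ) • e ι + ((∑ ν ∈ D, v ν • e ν) + ((v κ).sign * (j : ℤ)) • e κ) := by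
    intro j hj
    rw [disp_take_seg κ (v κ) j (Finset.mem_range.mp hj).le, add_assoc]
  have hcoord : ∀ (j : ℕ) (ν : Fin d), ((h : ℤ) • e ι + ((∑ ν ∈ D, v ν • e ν) + ((v κ).sign * (j : ℤ)) • e κ)) ν
      = (if ν = ι then (h : ℤ) else 0) + (if ν ∈ D then v ν else if ν = κ then (v κ).sign * (j : ℤ) else 0) := by
    intro j ν
    rw [Pi.add_apply, Pi.add_apply, sum_zsmul_e_apply, Pi.smul_apply, Pi.smul_apply, e_apply, e_apply, smul_eq_mul, smul_eq_mul, mul_ite, mul_one, mul_zero]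
    congr 1
    by_cases hνD : ν ∈ D
    · have hνκ : ν ≠ κ := fun h' => hκ (h' ▸ hνD)
      simp [hνD, hνκ]
    · by_cases hνκ : ν = κ
      · subst hνκ; simp [hκ]
      · simp [hνD, hνκ]
  -- inner points lie in the small box already
  have hinner : ∀ j ∈ Finset.range (v κ).natAbs,
      ((∑ ν ∈ D, v ν • e ν) + ((v κ).sign * (j : ℤ)) • e κ) ∈ Fintype.piFinset (fun _ : Fin d => Finset.Icc (-(R : ℤ)) (R : ℤ)) := by
    intro j hj
    have hjR : ((j : ℕ) : ℤ) ≤ R := by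
      have h1 := Finset.mem_range.mp hj
      have h2 := hvb κ
      omega
    rw [mem_box_iff]
    intro ν
    rw [Pi.add_apply, sum_zsmul_e_apply, Pi.smul_apply, e_apply, smul_eq_mul]
    by_cases hνD : ν ∈ D
    · have hνκ : ν ≠ κ := fun h' => hκ (h' ▸ hνD)
      rw [if_pos hνD, if_neg hνκ, mul_zero, add_zero]; exact hvb ν
    · rw [if_neg hνD, zero_add]
      by_cases hνκ : ν = κ
      · rw [if_pos hνκ, mul_one]
        rcases Int.sign_trichotomy (v κ) with hs | hs | hs <;> rw [hs] <;> constructor <;> omega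
      · rw [if_neg hνκ, mul_zero]; constructor <;> omega
  calc ∑ j ∈ Finset.range (v κ).natAbs, f ((h : ℤ) • e ι + (∑ ν ∈ D, v ν • e ν) + disp ((seg κ (v κ)).take j)) ((seg κ (v κ)).getD j dflt)
      ≤ ∑ j ∈ Finset.range (v κ).natAbs, (f ((h : ℤ) • e ι + ((∑ ν ∈ D, v ν • e ν) + ((v κ).sign * (j : ℤ)) • e κ)) (κ, true)
          + f ((h : ℤ) • e ι + ((∑ ν ∈ D, v ν • e ν) + ((v κ).sign * (j : ℤ)) • e κ)) (κ, false)) := by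
        refine Finset.sum_le_sum fun j hj => ?_
        rw [hpos j hj]
        rcases getD_seg κ (v κ) j (Finset.mem_range.mp hj) dflt with h' | h' <;> rw [h']
        · exact le_add_of_nonneg_right (hf _ _)
        · exact le_add_of_nonneg_left (hf _ _)
    _ = ∑ q ∈ (Finset.range (v κ).natAbs).image (fun j : ℕ => (h : ℤ) • e ι + ((∑ ν ∈ D, v ν • e ν) + ((v κ).sign * (j : ℤ)) • e κ)),
          (f q (κ, true) + f q (κ, false)) := by
        rw [Finset.sum_image]
        intro j₁ hj₁ j₂ _ hEq
        have hne : v κ ≠ 0 := by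
          intro h0
          have := Finset.mem_range.mp (Finset.mem_coe.mp hj₁)
          rw [h0] at this
          simp at this
        have h' := congrArg (fun p : Site d => p κ) hEq
        simp only [hcoord, hκ, hικ.symm, if_false, if_true, zero_add] at h'
        have hs : (v κ).sign ≠ 0 := fun h0 => hne (Int.sign_eq_zero_iff_zero.mp h0)
        exact_mod_cast mul_left_cancel₀ hs h'
    _ ≤ _ := by
        refine Finset.sum_le_sum_of_subset_of_nonneg (fun q hq => ?_) (fun q _ _ => add_nonneg (hf _ _) (hf _ _))
        rw [Finset.mem_image] at hq
        obtain ⟨j, hj, rfl⟩ := hq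
        rw [Finset.mem_filter]
        refine ⟨shift_mem_box ι hh (hinner j hj), fun ν hν => ?_, ?_⟩
        · have hνι : ν ≠ ι := fun h' => hι (h' ▸ hν)
          rw [hcoord, if_neg hνι, if_pos hν, zero_add]
        · rw [hcoord, if_pos rfl, if_neg hι, if_neg hικ, add_zero]

/-- ★★ (C3) **THE FIRST RUN SUMMED OVER THE OFFSETS CARRIES NO FACTOR `H`**: for `κ ∉ D`, `ι ∉ D`, `ι ≠ κ`,
`Σ_{h<H} Σ_{v∈box R} Σ_{j<|v κ|} f (h•e ι + base_D v + rung_j) letter_j ≤ (2R+1)^{d−|D|} · Σ_{q ∈ box (R+H)} (f q (κ,+) + f q (κ,−))` — an absolute rung position fixes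
the offset `h` (its `ι`-coordinate), so the fibre over `(h, v)` is the fibre over `v` alone. [cite: Balaban1985Averaging, (8)-(9) pp.18-19, p.24] -/
theorem sum_offsets_box_run_le (R H : ℕ) (D : Finset (Fin d)) (κ ι : Fin d) (hκ : κ ∉ D) (hι : ι ∉ D) (hικ : ι ≠ κ) (dflt : Letter d)
    (f : Site d → Letter d → ℝ) (hf : ∀ q b, 0 ≤ f q b) :
    ∑ h ∈ Finset.range H, ∑ v ∈ Fintype.piFinset (fun _ : Fin d => Finset.Icc (-(R : ℤ)) (R : ℤ)),
        ∑ j ∈ Finset.range (seg κ (v κ)).length, f ((h : ℤ) • e ι + (∑ ν ∈ D, v ν • e ν) + disp ((seg κ (v κ)).take j)) ((seg κ (v κ)).getD j dflt)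
      ≤ (((2 * R + 1) ^ (d - D.card) : ℕ) : ℝ)
        * ∑ q ∈ Fintype.piFinset (fun _ : Fin d => Finset.Icc (-((R + H : ℕ) : ℤ)) ((R + H : ℕ) : ℤ)), (f q (κ, true) + f q (κ, false)) := by
  classical
  set box := Fintype.piFinset (fun _ : Fin d => Finset.Icc (-(R : ℤ)) (R : ℤ)) with hbox
  set big := Fintype.piFinset (fun _ : Fin d => Finset.Icc (-((R + H : ℕ) : ℤ)) ((R + H : ℕ) : ℤ)) with hbig
  have hF : ∀ q, 0 ≤ f q (κ, true) + f q (κ, false) := fun q => add_nonneg (hf _ _) (hf _ _)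
  -- the small box sits inside the big one (used for the fibre bound)
  have hsub : ∀ q : Site d, (box.filter (fun v => ∀ ν ∈ D, q ν = v ν)).card ≤ (2 * R + 1) ^ (d - D.card) := fun q => card_filter_agree_le R D q
  calc ∑ h ∈ Finset.range H, ∑ v ∈ box, ∑ j ∈ Finset.range (seg κ (v κ)).length,
          f ((h : ℤ) • e ι + (∑ ν ∈ D, v ν • e ν) + disp ((seg κ (v κ)).take j)) ((seg κ (v κ)).getD j dflt)
      ≤ ∑ h ∈ Finset.range H, ∑ v ∈ box, ∑ q ∈ big.filter (fun q => (∀ ν ∈ D, q ν = v ν) ∧ q ι = (h : ℤ)), (f q (κ, true) + f q (κ, false)) :=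
        Finset.sum_le_sum fun h hh => Finset.sum_le_sum fun v hv =>
          sum_run_le_sum_agree_offset R H D κ ι hκ hι hικ dflt f hf (Finset.mem_range.mp hh) v hv
    _ = ∑ h ∈ Finset.range H, ∑ v ∈ box, ∑ q ∈ big, (if ((∀ ν ∈ D, q ν = v ν) ∧ q ι = (h : ℤ)) then (f q (κ, true) + f q (κ, false)) else 0) := by
        refine Finset.sum_congr rfl fun h _ => Finset.sum_congr rfl fun v _ => ?_
        rw [Finset.sum_filter]
    _ = ∑ h ∈ Finset.range H, ∑ q ∈ big, ∑ v ∈ box, (if ((∀ ν ∈ D, q ν = v ν) ∧ q ι = (h : ℤ)) then (f q (κ, true) + f q (κ, false)) else 0) :=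
        Finset.sum_congr rfl fun h _ => Finset.sum_comm
    _ = ∑ q ∈ big, ∑ h ∈ Finset.range H, ∑ v ∈ box, (if ((∀ ν ∈ D, q ν = v ν) ∧ q ι = (h : ℤ)) then (f q (κ, true) + f q (κ, false)) else 0) :=
        Finset.sum_comm
    _ ≤ ∑ q ∈ big, (((2 * R + 1) ^ (d - D.card) : ℕ) : ℝ) * (f q (κ, true) + f q (κ, false)) := by
        refine Finset.sum_le_sum fun q _ => ?_
        -- at most one offset `h` has `q ι = h`; for it, the `v`-fibre is the file-1 fibre
        have hstep : ∀ h ∈ Finset.range H,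
            ∑ v ∈ box, (if ((∀ ν ∈ D, q ν = v ν) ∧ q ι = (h : ℤ)) then (f q (κ, true) + f q (κ, false)) else 0)
              = if q ι = (h : ℤ) then ((box.filter (fun v => ∀ ν ∈ D, q ν = v ν)).card : ℝ) * (f q (κ, true) + f q (κ, false)) else 0 := by
          intro h _
          by_cases hq : q ι = (h : ℤ)
          · have hfilt : box.filter (fun v => (∀ ν ∈ D, q ν = v ν) ∧ q ι = (h : ℤ)) = box.filter (fun v => ∀ ν ∈ D, q ν = v ν) :=
              Finset.filter_congr (fun v _ => by simp [hq])
            rw [if_pos hq, ← Finset.sum_filter, Finset.sum_const, nsmul_eq_mul, hfilt]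
          · rw [if_neg hq]
            refine Finset.sum_eq_zero fun v _ => ?_
            rw [if_neg (fun h' => hq h'.2)]
        rw [Finset.sum_congr rfl hstep]
        have hone : ∑ h ∈ Finset.range H, (if q ι = (h : ℤ) then ((box.filter (fun v => ∀ ν ∈ D, q ν = v ν)).card : ℝ) * (f q (κ, true) + f q (κ, false)) else 0)
            ≤ ((box.filter (fun v => ∀ ν ∈ D, q ν = v ν)).card : ℝ) * (f q (κ, true) + f q (κ, false)) := by
          rcases em (∃ h ∈ Finset.range H, q ι = (h : ℤ)) with ⟨h₀, hh₀, hq₀⟩ | hno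
          · have heq : ∑ h ∈ Finset.range H, (if q ι = (h : ℤ) then ((box.filter (fun v => ∀ ν ∈ D, q ν = v ν)).card : ℝ) * (f q (κ, true) + f q (κ, false)) else 0)
                = ((box.filter (fun v => ∀ ν ∈ D, q ν = v ν)).card : ℝ) * (f q (κ, true) + f q (κ, false)) := by
              rw [Finset.sum_eq_single h₀ (fun b _ hne => if_neg (fun h' : q ι = (b : ℤ) => hne (by
                have hh : ((h₀ : ℕ) : ℤ) = b := hq₀.symm.trans h'
                exact_mod_cast hh.symm))) (fun h' => absurd hh₀ h'), if_pos hq₀]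
            exact heq.le
          · rw [Finset.sum_eq_zero (fun h hh => if_neg (fun h' => hno ⟨h, hh, h'⟩))]
            exact mul_nonneg (Nat.cast_nonneg _) (hF q)
        refine hone.trans (mul_le_mul_of_nonneg_right ?_ (hF q))
        exact_mod_cast hsub q
    _ = _ := by rw [← Finset.mul_sum]

/-! ## §3 (C3) The later runs under the offsets, and the assembly -/

/-- Shifting the small box `H` times along `e ι` covers each point of the big box at most `H` times:
`Σ_{h<H} Σ_{q∈box R} F (h•e ι + q) ≤ H · Σ_{q∈box (R+H)} F q` (`F ≥ 0`). [folklore] -/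
theorem sum_offsets_shift_le (R H : ℕ) (ι : Fin d) (F : Site d → ℝ) (hF : ∀ q, 0 ≤ F q) :
    ∑ h ∈ Finset.range H, ∑ q ∈ Fintype.piFinset (fun _ : Fin d => Finset.Icc (-(R : ℤ)) (R : ℤ)), F ((h : ℤ) • e ι + q)
      ≤ (H : ℝ) * ∑ q ∈ Fintype.piFinset (fun _ : Fin d => Finset.Icc (-((R + H : ℕ) : ℤ)) ((R + H : ℕ) : ℤ)), F q := by
  classical
  have hstep : ∀ h ∈ Finset.range H,
      ∑ q ∈ Fintype.piFinset (fun _ : Fin d => Finset.Icc (-(R : ℤ)) (R : ℤ)), F ((h : ℤ) • e ι + q)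
        ≤ ∑ q ∈ Fintype.piFinset (fun _ : Fin d => Finset.Icc (-((R + H : ℕ) : ℤ)) ((R + H : ℕ) : ℤ)), F q := by
    intro h hh
    rw [← Finset.sum_image (f := F) (s := Fintype.piFinset (fun _ : Fin d => Finset.Icc (-(R : ℤ)) (R : ℤ)))
      (g := fun q => (h : ℤ) • e ι + q) (fun q₁ _ q₂ _ hq => add_left_cancel hq)]
    refine Finset.sum_le_sum_of_subset_of_nonneg (fun q hq => ?_) (fun q _ _ => hF q)
    rw [Finset.mem_image] at hq
    obtain ⟨q', hq', rfl⟩ := hq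
    exact shift_mem_box ι (Finset.mem_range.mp hh) hq'
  calc _ ≤ ∑ h ∈ Finset.range H, ∑ q ∈ Fintype.piFinset (fun _ : Fin d => Finset.Icc (-((R + H : ℕ) : ℤ)) ((R + H : ℕ) : ℤ)), F q :=
        Finset.sum_le_sum hstep
    _ = _ := by rw [Finset.sum_const, Finset.card_range, nsmul_eq_mul]

/-- ★★★ (C3) **THE COUNT UNDER THE OFFSET FAMILY**: for `t = κ :: t'` duplicate-free and disjoint from `D`, `ι ∈ t'` (a LATER direction), every nonnegative weight and `H`
offsets `h • e ι` of the base: the first run's rung sums over ALL offsets cost `(2R+1)^{d−|D|}` ONCE (no factor `H`), the later runs cost their file-1 factors `H` times —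
dividing by `H` (the average) is the consumer's. [cite: Balaban1985Averaging, (8)-(9) pp.18-19, p.24; Balaban1985UV3, (27) p.263] -/
theorem sum_offsets_box_sum_rungs_le (R H : ℕ) (dflt : Letter d) (κ₀ : Fin d) (f : Site d → Letter d → ℝ) (hf : ∀ q b, 0 ≤ f q b)
    (κ ι : Fin d) (t : List (Fin d)) (D : Finset (Fin d)) (hnd : (κ :: t).Nodup) (hD : ∀ κ' ∈ κ :: t, κ' ∉ D) (hι : ι ∈ t) :
    ∑ h ∈ Finset.range H, ∑ v ∈ Fintype.piFinset (fun _ : Fin d => Finset.Icc (-(R : ℤ)) (R : ℤ)),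
        ∑ k ∈ Finset.range ((κ :: t).flatMap (fun κ => seg κ (v κ))).length,
          f ((h : ℤ) • e ι + (∑ ν ∈ D, v ν • e ν) + disp (((κ :: t).flatMap (fun κ => seg κ (v κ))).take k))
            (((κ :: t).flatMap (fun κ => seg κ (v κ))).getD k dflt)
      ≤ (((2 * R + 1) ^ (d - D.card) : ℕ) : ℝ)
          * ∑ q ∈ Fintype.piFinset (fun _ : Fin d => Finset.Icc (-((R + H : ℕ) : ℤ)) ((R + H : ℕ) : ℤ)), (f q (κ, true) + f q (κ, false))
        + (H : ℝ) * ∑ i ∈ Finset.range t.length, (((2 * R + 1) ^ (d - (D.card + 1 + i)) : ℕ) : ℝ)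
          * ∑ q ∈ Fintype.piFinset (fun _ : Fin d => Finset.Icc (-((R + H : ℕ) : ℤ)) ((R + H : ℕ) : ℤ)), (f q (t.getD i κ₀, true) + f q (t.getD i κ₀, false)) := by
  classical
  have hκD : κ ∉ D := hD κ (by simp)
  have hκt : κ ∉ t := (List.nodup_cons.mp hnd).1
  have hnd' : t.Nodup := (List.nodup_cons.mp hnd).2
  have hιD : ι ∉ D := hD ι (by simp [hι])
  have hικ : ι ≠ κ := fun h' => hκt (h' ▸ hι)
  have hD' : ∀ κ' ∈ t, κ' ∉ insert κ D := by
    intro κ' hκ' hmem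
    rcases Finset.mem_insert.mp hmem with h1 | h1
    · exact hκt (h1 ▸ hκ')
    · exact hD κ' (by simp [hκ']) h1
  -- split every comb's rung sum at the end of the first run, with the offset absorbed into the base point
  have hsplit : ∀ (h : ℕ) (v : Site d),
      ∑ k ∈ Finset.range ((κ :: t).flatMap (fun κ => seg κ (v κ))).length,
          f ((h : ℤ) • e ι + (∑ ν ∈ D, v ν • e ν) + disp (((κ :: t).flatMap (fun κ => seg κ (v κ))).take k)) (((κ :: t).flatMap (fun κ => seg κ (v κ))).getD k dflt)
        = ∑ j ∈ Finset.range (seg κ (v κ)).length, f ((h : ℤ) • e ι + (∑ ν ∈ D, v ν • e ν) + disp ((seg κ (v κ)).take j)) ((seg κ (v κ)).getD j dflt)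
          + ∑ k ∈ Finset.range (t.flatMap (fun κ => seg κ (v κ))).length,
              f ((h : ℤ) • e ι + ((∑ ν ∈ insert κ D, v ν • e ν) + disp ((t.flatMap (fun κ => seg κ (v κ))).take k))) ((t.flatMap (fun κ => seg κ (v κ))).getD k dflt) := by
    intro h v
    rw [List.flatMap_cons, sum_range_rungs_append f dflt _ (seg κ (v κ)) _, disp_seg, Finset.sum_insert hκD]
    congr 1
    refine Finset.sum_congr rfl fun k _ => ?_
    congr 1
    abel
  rw [Finset.sum_congr rfl fun h _ => Finset.sum_congr rfl fun v _ => hsplit h v]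
  have hdist : ∑ h ∈ Finset.range H, ∑ v ∈ Fintype.piFinset (fun _ : Fin d => Finset.Icc (-(R : ℤ)) (R : ℤ)),
      (∑ j ∈ Finset.range (seg κ (v κ)).length, f ((h : ℤ) • e ι + (∑ ν ∈ D, v ν • e ν) + disp ((seg κ (v κ)).take j)) ((seg κ (v κ)).getD j dflt)
        + ∑ k ∈ Finset.range (t.flatMap (fun κ => seg κ (v κ))).length,
            f ((h : ℤ) • e ι + ((∑ ν ∈ insert κ D, v ν • e ν) + disp ((t.flatMap (fun κ => seg κ (v κ))).take k))) ((t.flatMap (fun κ => seg κ (v κ))).getD k dflt))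
      = (∑ h ∈ Finset.range H, ∑ v ∈ Fintype.piFinset (fun _ : Fin d => Finset.Icc (-(R : ℤ)) (R : ℤ)),
          ∑ j ∈ Finset.range (seg κ (v κ)).length, f ((h : ℤ) • e ι + (∑ ν ∈ D, v ν • e ν) + disp ((seg κ (v κ)).take j)) ((seg κ (v κ)).getD j dflt))
        + ∑ h ∈ Finset.range H, ∑ v ∈ Fintype.piFinset (fun _ : Fin d => Finset.Icc (-(R : ℤ)) (R : ℤ)),
            ∑ k ∈ Finset.range (t.flatMap (fun κ => seg κ (v κ))).length,
              f ((h : ℤ) • e ι + ((∑ ν ∈ insert κ D, v ν • e ν) + disp ((t.flatMap (fun κ => seg κ (v κ))).take k))) ((t.flatMap (fun κ => seg κ (v κ))).getD k dflt) := by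
    rw [← Finset.sum_add_distrib]
    exact Finset.sum_congr rfl fun h _ => Finset.sum_add_distrib
  rw [hdist]
  refine add_le_add (sum_offsets_box_run_le R H D κ ι hκD hιD hικ dflt f hf) ?_
  -- the later runs: file-1 count per offset with the shifted weight, then the shift lemma
  have hper : ∀ h ∈ Finset.range H,
      ∑ v ∈ Fintype.piFinset (fun _ : Fin d => Finset.Icc (-(R : ℤ)) (R : ℤ)),
          ∑ k ∈ Finset.range (t.flatMap (fun κ => seg κ (v κ))).length,
            f ((h : ℤ) • e ι + ((∑ ν ∈ insert κ D, v ν • e ν) + disp ((t.flatMap (fun κ => seg κ (v κ))).take k))) ((t.flatMap (fun κ => seg κ (v κ))).getD k dflt)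
        ≤ ∑ i ∈ Finset.range t.length, (((2 * R + 1) ^ (d - (D.card + 1 + i)) : ℕ) : ℝ)
            * ∑ q ∈ Fintype.piFinset (fun _ : Fin d => Finset.Icc (-(R : ℤ)) (R : ℤ)),
                (f ((h : ℤ) • e ι + q) (t.getD i κ₀, true) + f ((h : ℤ) • e ι + q) (t.getD i κ₀, false)) := by
    intro h _
    have := sum_box_sum_rungs_le R dflt κ₀ (fun q b => f ((h : ℤ) • e ι + q) b) (fun q b => hf _ _) t (insert κ D) hnd' hD'
    rwa [Finset.card_insert_of_notMem hκD] at this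
  calc _ ≤ ∑ h ∈ Finset.range H, ∑ i ∈ Finset.range t.length, (((2 * R + 1) ^ (d - (D.card + 1 + i)) : ℕ) : ℝ)
            * ∑ q ∈ Fintype.piFinset (fun _ : Fin d => Finset.Icc (-(R : ℤ)) (R : ℤ)),
                (f ((h : ℤ) • e ι + q) (t.getD i κ₀, true) + f ((h : ℤ) • e ι + q) (t.getD i κ₀, false)) := Finset.sum_le_sum hper
    _ = ∑ i ∈ Finset.range t.length, (((2 * R + 1) ^ (d - (D.card + 1 + i)) : ℕ) : ℝ)
            * ∑ h ∈ Finset.range H, ∑ q ∈ Fintype.piFinset (fun _ : Fin d => Finset.Icc (-(R : ℤ)) (R : ℤ)),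
                (f ((h : ℤ) • e ι + q) (t.getD i κ₀, true) + f ((h : ℤ) • e ι + q) (t.getD i κ₀, false)) := by
        rw [Finset.sum_comm]
        refine Finset.sum_congr rfl fun i _ => ?_
        rw [Finset.mul_sum]
    _ ≤ ∑ i ∈ Finset.range t.length, (((2 * R + 1) ^ (d - (D.card + 1 + i)) : ℕ) : ℝ)
            * ((H : ℝ) * ∑ q ∈ Fintype.piFinset (fun _ : Fin d => Finset.Icc (-((R + H : ℕ) : ℤ)) ((R + H : ℕ) : ℤ)),
                (f q (t.getD i κ₀, true) + f q (t.getD i κ₀, false))) := by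
        refine Finset.sum_le_sum fun i _ => mul_le_mul_of_nonneg_left ?_ (by positivity)
        exact sum_offsets_shift_le R H ι (fun q => f q (t.getD i κ₀, true) + f q (t.getD i κ₀, false)) (fun q => add_nonneg (hf _ _) (hf _ _))
    _ = _ := by
        simp only [Finset.mul_sum]
        exact Finset.sum_congr rfl fun i _ => Finset.sum_congr rfl fun q _ => by ring

end Summit.QuantumFields.YangMills.Theorems.Prop7CombLadderCountOffset
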